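/-
Copyright (c) 2026 the pub-hodgecm-mathlib formalisation cell (harness21).  Prover seat hodgecm-mathlib-LH4-p11 (g5), req620 Track A «(D-RAM) FOUR-FRAME» squad
(unit U2H_HSide, the (ρ2b′-X) road :418; payer by lineage LH4-p14 (g4) 2026-09-04T06:33Z «bottom (A) → LH4-p11»).
-/
import Summits.HodgeConjecture.HodgeConjecture.Theorems.F0P3cDyRamThirdFieldPackageUnr   -- ★ p857839 (F0P3a-p01): `exists_aux_unit`, `exists_unit_mul_map_eq` (Serre V §2 on `𝒪[M]`)
import Literature.NumberTheory.Automorphic.UnitaryThreeFourFrameDefs                        -- ★ `IsRamifiedQuadraticDatum`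
import Literature.NumberTheory.Automorphic.UnitaryGroupAutomorphicRep                      -- ★ `unitaryGroupOfForm`, `mem_unitaryGroupOfForm_iff`
import HarnessLib

/-!
# Crux `H413`, line LH4 «(D-RAM) FOUR-FRAME» — the (ρ2b′-X) road, bottom socket (A) (type U): FRAME FACTS OF THE BOTTOM PROVER
# (the `hFN` conjunct on type U; the E-datum transported to the line-model field; the `U(1)`-part of `γ_H`)

Cell `hodgecm-mathlib` (D-0151), FLOOR 0, crux item H413 = `stmt-HodgeConjecture-24833`, route of record `HCCMUnconditional`; squad F0∕P3c∕LH4; socket served: bottom (A)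
`F0/P3c/LH4/LH4-p14/g4/split/SOCKET-hOCA.v1.LH4p14g4.txt` 0e05dba0 (= (C⁗) v2 + the type-U letters `|α − ρα| = 1`, `|ρα − Θα| < 1`; payer LH4-p14 (g4)'s TypeSplit).
THEOREMS ONLY (no `def`, no instance, no notation, no `sorry`, default heartbeats); lane `--supports stmt-HodgeConjecture-24833 --as helper` (count-neutral).  ABSTRACT letters:
`E` the place field (σ, ϖ, the datum `(d, t)`), `M` the line-model field (ρ, Θ, α), `jE : E →+* M` with the socket's dictionary (`hΘj`, `hjfix`, `hjpow`).

* §1 `forall_fixed_fixed_isNorm_of_typeU` — **THE `hFN` CONJUNCT OF (A)**: on type U (`|α − ρα| = 1`, `|ρα − Θα| < 1`, `M` complete with finite residue field) every unit of `M`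
  fixed by `Θ` (a fortiori by `ρ` and `Θ`) is a hermitian norm `z·Θz` — ★ S2′ `exists_aux_unit` (an integer moved by `Θ` by a unit) ∘ ★ `exists_unit_mul_map_eq` (Serre V §2 Prop. 3
  on `𝒪[M]`).
* §2 `v_map_eq_of_uniformizer` and the TRANSPORTED DATUM: once `|jE ϖ| = exp(−1)` (type U: `e(w₁|w) = 1`, the (S2′-E) dictionary of LH4-p10), `hjpow` makes `jE` an ISOMETRY, and
  then `|jE ϖ − Θ(jE ϖ)| = |jE ϖ|^d` (`hddE`), doubly-fixed non-zero elements have even order (`hfixE`), `|2|_M = |jE ϖ|^t` (`h2`) — the three frame letters of ★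
  `toricCensusSum_unr_weld_of_frame` that come from the E-datum.
* §3 `mul_map_eq_one_of_mem_unitary_one` — a `1 × 1` unitary matrix entry `g₀₀` for a non-zero `1 × 1` form has `σ(g₀₀)·g₀₀ = 1`; transported: `Θ(jE g₀₀)·jE g₀₀ = 1`,
  `ρ(jE g₀₀) = jE g₀₀` (the weld's `hu`, `hu1` for `u := jE u₀₀`).
HONEST LABEL.  Count-neutral; nothing printed is asserted; (ρ2b′-X) stays OPEN; `HC_CM` is proved only modulo the 7 printed citations (2 remaining named inputs: hLiu418 =
`stmt-HodgeConjecture-24832`, h413 = `stmt-HodgeConjecture-24833`) until rung 0 closes.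

## References
* [Serre1979] J.-P. Serre, *Local Fields*, GTM 67 (1979), Ch. V §2 Prop. 3 and Cor. (unit norms in an unramified extension); Ch. II §2.
* [Rogawski1990] J. D. Rogawski, *Automorphic Representations of Unitary Groups in Three Variables*, Ann. of Math. Stud. 123 (1990), §4.9 Lemma 4.9.3 p. 56.
* [Jacobowitz1962] R. Jacobowitz, *Hermitian forms over local fields*, Amer. J. Math. 84 (1962), §4.
-/

set_option autoImplicit false

noncomputable section

open scoped Valued WithZero Matrix MatrixGroups
open WithZero
open Literature.NumberTheory.Automorphic Literature.NumberTheory.Automorphic.UnitaryGroup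
open Literature.NumberTheory.Automorphic.UnitaryThreeFourFrame (IsRamifiedQuadraticDatum)
open Summit.HodgeConjecture.HodgeConjecture.Cruxes.H413.F0P3cDyRamThirdFieldPackageUnr

namespace Summit.HodgeConjecture.HodgeConjecture.Cruxes.H413.F0P3cDyRamTypeUBottomFacts

/-! ## §1 The `hFN` conjunct on type U -/

section Norm

variable {M : Type} [Field M] [Valued M ℤᵐ⁰] {ρ Θ : M →+* M} {α : M}

/-- **`hFN` ON TYPE U.**  If `M` is complete with finite residue field and has a uniformiser `P`, `ρ`, `Θ` are commuting isometric involutions, `|α| ≤ 1`, `|α − ρα| = 1` and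
`|ρα − Θα| < 1` (the type-U letters of socket (A)), then EVERY `Θ`-fixed unit `f` of `M` is a hermitian norm `z·Θz` (★ S2′ `exists_aux_unit` gives an integer `α′` with
`|Θα′ − α′| = 1`; ★ `exists_unit_mul_map_eq` is Serre V §2 Prop. 3 on `𝒪[M]`).  In particular the socket's clause `∀ f, ρf = f → Θf = f → |f| = 1 → ∃ z, z·Θz = f`.
[cite: Serre1979, Ch. V §2 Prop. 3 and Cor.] -/
theorem forall_fixed_fixed_isNorm_of_typeU [CompleteSpace M] [Finite 𝓀[M]]
    (hvρ : ∀ x, Valued.v (ρ x) = Valued.v x) (hΘΘ : ∀ x, Θ (Θ x) = x) (hvΘ : ∀ x, Valued.v (Θ x) = Valued.v x)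
    (hα1 : Valued.v α ≤ 1) (hα : Valued.v (α - ρ α) = 1) (hτα : Valued.v (ρ α - Θ α) < 1)
    {P : M} (hvP : Valued.v P = exp (-1 : ℤ)) :
    ∀ f : M, ρ f = f → Θ f = f → Valued.v f = 1 → ∃ z : M, z * Θ z = f := by
  intro f _ hΘf hf1
  obtain ⟨α', hα'1, hm, -, hτ⟩ := exists_aux_unit hvρ hα1 hα hτα
  have hΘα' : Valued.v (Θ α' - α') = 1 := by
    have hτ' : Valued.v (Θ α' - ρ α') < 1 := by rw [Valuation.map_sub_swap]; exact hτ
    rw [show Θ α' - α' = (ρ α' - α') + (Θ α' - ρ α') by ring,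
      Valuation.map_add_eq_of_lt_left _ (by rw [Valuation.map_sub_swap _ (ρ α') α', hm]; exact hτ'), Valuation.map_sub_swap _ (ρ α') α', hm]
  have hf0 : f ≠ 0 := fun h0 => by rw [h0, map_zero] at hf1; exact zero_ne_one hf1
  obtain ⟨ω, -, hω⟩ := exists_unit_mul_map_eq hΘΘ hvΘ hα'1 hΘα' hvP (Units.mk0 f hf0) hΘf hf1
  exact ⟨ω, hω⟩

end Norm

/-! ## §2 The E-datum transported along an isometric `jE` -/

section Transport

variable {E : Type} {M : Type*} [Field E] [Valued E ℤᵐ⁰] [Field M] [Valued M ℤᵐ⁰] {ρ Θ : M →+* M}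

/-- **`jE` IS AN ISOMETRY once it carries the uniformiser to a uniformiser**: from the socket's power dictionary `hjpow` and `|jE ϖ| = exp(−1) = |ϖ|`, `|jE t| = |t|` for all `t`.
[cite: Serre1979, Ch. II §2] -/
theorem v_map_eq_of_uniformizer (jE : E →+* M) {ϖ : E} (hϖ : Valued.v ϖ = exp (-1 : ℤ))
    (hjpow : ∀ (t : E) (n : ℤ), Valued.v (jE t) = Valued.v (jE ϖ) ^ n ↔ Valued.v t = Valued.v ϖ ^ n)
    (hϖE : Valued.v (jE ϖ) = exp (-1 : ℤ)) (t : E) : Valued.v (jE t) = Valued.v t := by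
  by_cases ht : t = 0
  · rw [ht, map_zero, Valuation.map_zero, Valuation.map_zero]
  · have hvt0 : Valued.v t ≠ 0 := (Valuation.ne_zero_iff _).2 ht
    -- `|t| = exp k = |ϖ|^(−k)`
    obtain ⟨k, hk⟩ : ∃ k : ℤ, Valued.v t = exp k := ⟨_, (exp_log hvt0).symm⟩
    have hk' : Valued.v t = Valued.v ϖ ^ (-k) := by
      rw [hk, hϖ, ← exp_zsmul, smul_eq_mul]; ring_nf
    have h := (hjpow t (-k)).2 hk'
    rw [h, hϖE, ← hϖ, ← hk']

/-- **THE TRANSPORTED DATUM** (the weld's `hddE`, `hfixE`, `h2`): with `jE` an isometry intertwining `σ` and `Θ` (`Θ ∘ jE = jE ∘ σ`) onto the `ρ`-fixed elements, the E-datum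
`IsRamifiedQuadraticDatum σ ϖ d t` gives on `M`: `|jE ϖ − Θ(jE ϖ)| = |jE ϖ|^d`; every non-zero `z` with `ρz = z`, `Θz = z` has `|z| = exp(2n)`; `|2| = |jE ϖ|^t`.
[cite: Serre1979, Ch. II §2] [cite: Rogawski1990, §4.9 Lemma 4.9.3 p. 56] -/
theorem transported_datum (σ : E →+* E) {ϖ : E} {d t : ℕ} (hD : IsRamifiedQuadraticDatum σ ϖ d t) (jE : E →+* M)
    (hΘj : ∀ x, Θ (jE x) = jE (σ x)) (hjfix : ∀ z, ρ z = z ↔ ∃ c, jE c = z)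
    (hjpow : ∀ (t : E) (n : ℤ), Valued.v (jE t) = Valued.v (jE ϖ) ^ n ↔ Valued.v t = Valued.v ϖ ^ n)
    (hϖE : Valued.v (jE ϖ) = exp (-1 : ℤ)) :
    Valued.v (jE ϖ - Θ (jE ϖ)) = Valued.v (jE ϖ) ^ d ∧
      (∀ z : M, ρ z = z → Θ z = z → z ≠ 0 → ∃ n : ℤ, Valued.v z = exp (2 * n)) ∧
      Valued.v (2 : M) = Valued.v (jE ϖ) ^ t := by
  obtain ⟨_, _, hϖ, hfix, hdd, _, h2⟩ := hD
  have hiso := v_map_eq_of_uniformizer jE hϖ hjpow hϖE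
  refine ⟨?_, ?_, ?_⟩
  · rw [hΘj, ← map_sub, hiso, hdd, hiso]
  · intro z hρz hΘz hz0
    obtain ⟨c, rfl⟩ := (hjfix z).1 hρz
    have hσc : σ c = c := jE.injective (by rw [← hΘj, hΘz])
    have hc0 : c ≠ 0 := fun h0 => hz0 (by rw [h0, map_zero])
    obtain ⟨n, hn⟩ := hfix c hσc hc0
    exact ⟨n, by rw [hiso, hn]⟩
  · rw [show (2 : M) = jE 2 from (map_ofNat jE 2).symm, hiso, h2, hiso]

end Transport

/-! ## §3 The `U(1)`-part of `γ_H`: a `1 × 1` unitary entry has `σ`-norm one -/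

section One

variable {E : Type*} {M : Type*} [CommRing E] [Field M] {ρ Θ : M →+* M}

/-- A `1 × 1` matrix `g` unitary for the `1 × 1` form `H` with `H₀₀` not a zero divisor satisfies `σ(g₀₀)·g₀₀ = 1`. [cite: Rogawski1990, §4.9 Lemma 4.9.3 p. 56] -/
theorem mul_map_eq_one_of_mem_unitary_one (σ : E →+* E) {H : Matrix (Fin 1) (Fin 1) E} (hH : IsUnit (H 0 0)) {g : GL (Fin 1) E}
    (hg : g ∈ unitaryGroupOfForm σ H) : σ ((g : Matrix (Fin 1) (Fin 1) E) 0 0) * (g : Matrix (Fin 1) (Fin 1) E) 0 0 = 1 := by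
  rw [mem_unitaryGroupOfForm_iff] at hg
  have h00 := congrFun (congrFun hg 0) 0
  simp only [Matrix.mul_apply, Fin.sum_univ_one, Matrix.transpose_apply, Matrix.map_apply] at h00
  -- `σ g₀₀ · H₀₀ · g₀₀ = H₀₀`
  have h1 : (σ ((g : Matrix (Fin 1) (Fin 1) E) 0 0) * (g : Matrix (Fin 1) (Fin 1) E) 0 0 - 1) * H 0 0 = 0 := by
    have h' : σ ((g : Matrix (Fin 1) (Fin 1) E) 0 0) * (g : Matrix (Fin 1) (Fin 1) E) 0 0 * H 0 0 = H 0 0 := by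
      rw [show σ ((g : Matrix (Fin 1) (Fin 1) E) 0 0) * (g : Matrix (Fin 1) (Fin 1) E) 0 0 * H 0 0 =
        σ ((g : Matrix (Fin 1) (Fin 1) E) 0 0) * H 0 0 * (g : Matrix (Fin 1) (Fin 1) E) 0 0 by ring]
      exact h00
    rw [sub_mul, one_mul, h', sub_self]
  exact sub_eq_zero.1 ((hH.mul_left_eq_zero).1 h1)

/-- **THE WELD'S `u`-LETTERS**: for `u₀₀` with `σ(u₀₀)·u₀₀ = 1` and `jE` intertwining `σ`∕`Θ` onto the `ρ`-fixed elements, `u := jE u₀₀` satisfies `ρu = u` and `u·Θu = 1`.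
[cite: Rogawski1990, §4.9 Lemma 4.9.3 p. 56] -/
theorem map_fixed_and_mul_map_eq_one {E : Type*} [Field E] (σ : E →+* E) (jE : E →+* M) (hΘj : ∀ x, Θ (jE x) = jE (σ x))
    (hjfix : ∀ z, ρ z = z ↔ ∃ c, jE c = z) {u₀ : E} (hu₀ : σ u₀ * u₀ = 1) :
    ρ (jE u₀) = jE u₀ ∧ jE u₀ * Θ (jE u₀) = 1 :=
  ⟨(hjfix _).2 ⟨u₀, rfl⟩, by rw [hΘj, ← map_mul, mul_comm, hu₀, map_one]⟩

end One

end Summit.HodgeConjecture.HodgeConjecture.Cruxes.H413.F0P3cDyRamTypeUBottomFacts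

end
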